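import Summits.QuantumAdvantage.QuantumAdvantage.Theorems.CubicForrelationNearExactIsExactWalshTower
import Summits.QuantumAdvantage.QuantumAdvantage.Theorems.CubicForrelationNearExactIsExactAxParity
import Literature.Computability.QuantumComplexity.ForrelationDirectSum

/-!
# Crux `CubicForrelation.NearExactIsExact` (stmt-QuantumAdvantage-14043), line `direct-sum-amplification`, lead c6 cycle 2:
  stub `stub_levelOnHyperplane` — the 2-adic Walsh tower relative to a coordinate hyperplane

Same mechanism as the landed `stub_walshTower` (file `…WalshTower.lean`, whose proof is 25 lines: `bb_moebius_isDegLeFun`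
+ `bb_poisson` + Ax), but the divisibility hypothesis `W_g = 2^j u` is only assumed on the hyperplane `{x_last = b}` and the
conclusion is about the parity of `u` as a function of the `N` free coordinates (`Fin.snoc x̄ b`).  For `b = true` first replace
`g` by `g ⊕ y_last` (this shifts `W` by `e_last`: `W_{g ⊕ y_last}(x) = W_g(x ⊕ e_last)`), reducing to `b = false`; then the cubes of
the hyperplane based at `0` are the coordinate cubes `E_I ⊂ 𝔽₂^{N+1}` with `last ∉ I`, and for `|I| > d`:
`2^j Σ_{E_I} u = Σ_{E_I} W_g = 2^{|I|} Σ_{E_{Iᶜ}} (−1)^g ∈ 2^{|I| + ⌈(N+1−|I|)/3⌉} ℤ` (Poisson, then Ax with `K = Iᶜ`,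
`|Iᶜ| = N + 1 − |I|`), so `Σ_{E_I} u` is even by the side condition; transport the cube `E_I` (`I ⊆ Fin N`) along
`x̄ ↦ Fin.snoc x̄ false` and conclude with Möbius on `N` variables.  Used by the lead at `N = 9`, `j = 5`, `d = 2`: in the
split case the level-5 parity on the heavy hyperplane `H′` is quadratic, hence (weight `< 128`) identically odd.

In the Lean proof both values of `b` are treated at once through the shift `g ↦ g ⊕ (b ∧ y_last)` (`loh_W_snoc`:
`W_g(x̄ ‖ b) = W_{g ⊕ (b ∧ y_last)}(x̄ ‖ 0)`, via `signOf_xor` of `ForrelationDirectSum`; `loh_isDegLeFun_shift`: the shift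
is cubic), the cube transport is `loh_sum_transport` (`Finset.sum_nbij'` with `Fin.snoc · false` / `Fin.init`), and the
hyperplane-`0` tower is `loh_of_false`.
Sources: J. Ax, *Zeroes of polynomials over finite fields*, Amer. J. Math. 86 (1964); C. Carlet, *Boolean Functions for
Cryptography and Coding Theory*, CUP 2021, §2.2 and Thm 13 (as in the Rothaus / WalshTower files). Everything below is
proved from Mathlib and the tree (`bb_poisson`, `bb_moebius_isDegLeFun`, `tw_even_sum_iff`, `tw_even_of_balance`); Ax's
theorem enters only as the hypothesis `hAx`; axioms are the standard three.
-/

set_option linter.dupNamespace false -- D-0017: single-problem summit ⇒ `QuantumAdvantage.QuantumAdvantage` by design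

noncomputable section

namespace Summit.QuantumAdvantage.QuantumAdvantage.Theorems.CubicForrelation.NearExactIsExact

open Finset
open Literature.Computability.QuantumComplexity
open Literature.Computability.QuantumComplexity.BuzetChailloux (bxor zeroVec signOf_sq)
open Literature.Computability.QuantumComplexity.DerivativeWalsh (W)

/-! ### The shift `g ↦ g ⊕ (b ∧ y_last)`: moving the hyperplane `{x_last = b}` to `{x_last = 0}` -/

/-- The character at `x̄ ‖ b` versus the character at `x̄ ‖ 0`: `(−1)^{y·(x̄‖b)} = (−1)^{y·(x̄‖0)} (−1)^{y_last ∧ b}`. -/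
theorem loh_twist_snoc {N : ℕ} (y : Fin (N + 1) → Bool) (x : Fin N → Bool) (b : Bool) :
    twist y (Fin.snoc x b) = twist y (Fin.snoc x false) * signOf (y (Fin.last N) && b) := by
  unfold twist signOf
  rw [Fin.prod_univ_castSucc, Fin.prod_univ_castSucc]
  simp

/-- **The Walsh shift.** `W_g(x̄ ‖ b) = W_{g ⊕ (b ∧ y_last)}(x̄ ‖ 0)`: twisting `g` by the last coordinate moves the
hyperplane `{x_last = b}` of the spectrum onto `{x_last = 0}`. -/
theorem loh_W_snoc {N : ℕ} (g : (Fin (N + 1) → Bool) → Bool) (x : Fin N → Bool) (b : Bool) :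
    W (fun y => signOf (g y)) (Fin.snoc x b) =
      W (fun y => signOf (g y ^^ (y (Fin.last N) && b))) (Fin.snoc x false) := by
  unfold W
  refine sum_congr rfl fun y _ => ?_
  dsimp only
  rw [loh_twist_snoc y x b, signOf_xor]
  ring

/-- The shifted function `g ⊕ (b ∧ y_last)` is again cubic (add the degree-`1` monomial `X_last` when `b = 1`). -/
theorem loh_isDegLeFun_shift {N : ℕ} {g : (Fin (N + 1) → Bool) → Bool} (hg : IsDegLeFun 3 g) (b : Bool) :
    IsDegLeFun 3 (fun y => g y ^^ (y (Fin.last N) && b)) := by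
  obtain ⟨p, hp, hpg⟩ := hg
  cases b
  · refine ⟨p, hp, fun y => ?_⟩
    simp only [Bool.and_false, Bool.xor_false]
    exact hpg y
  · refine ⟨p + MvPolynomial.X (Fin.last N), (MvPolynomial.totalDegree_add _ _).trans
      (max_le hp ((MvPolynomial.totalDegree_X (R := ZMod 2) (Fin.last N)).le.trans (by norm_num))), fun y => ?_⟩
    simp only [Bool.and_true]
    rw [hpg y, polyPhase_apply, polyPhase_apply, map_add, MvPolynomial.eval_X]
    generalize MvPolynomial.eval (fun j => if y j = true then (1 : ZMod 2) else 0) p = a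
    cases y (Fin.last N) <;> revert a <;> decide

/-! ### Transport of coordinate cubes along `x̄ ↦ x̄ ‖ 0` -/

/-- The cube `E_I ⊂ 𝔽₂^N` (`I ⊆ Fin N`) is carried by `x̄ ↦ x̄ ‖ 0` bijectively onto the cube `E_{I'} ⊂ 𝔽₂^{N+1}` of the
same coordinate set viewed in `Fin (N + 1)` (`I' = castSucc '' I`, so `last ∉ I'`). -/
theorem loh_sum_transport {N : ℕ} (F : (Fin (N + 1) → Bool) → ℝ) (I : Finset (Fin N)) :
    ∑ x ∈ {x : Fin N → Bool | ∀ i, x i = true → i ∈ I}, F (Fin.snoc x false) =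
      ∑ y ∈ {y : Fin (N + 1) → Bool | ∀ i, y i = true → i ∈ I.map Fin.castSuccEmb}, F y := by
  refine sum_nbij' (fun x => Fin.snoc x false) (fun y i => y (Fin.castSucc i)) ?_ ?_ ?_ ?_ fun _ _ => rfl
  · intro x hx
    simp only [mem_filter, mem_univ, true_and] at hx ⊢
    intro i hi
    rcases Fin.eq_castSucc_or_eq_last i with ⟨i, rfl⟩ | rfl
    · rw [Fin.snoc_castSucc] at hi
      exact (mem_map' Fin.castSuccEmb).2 (hx i hi)
    · rw [Fin.snoc_last] at hi
      exact absurd hi Bool.false_ne_true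
  · intro y hy
    simp only [mem_filter, mem_univ, true_and] at hy ⊢
    intro i hi
    exact (mem_map' Fin.castSuccEmb).1 (hy (Fin.castSucc i) hi)
  · intro x _
    exact Fin.init_snoc _ _
  · intro y hy
    simp only [mem_filter, mem_univ, true_and] at hy
    have hl : y (Fin.last N) = false := by
      cases h : y (Fin.last N)
      · rfl
      · obtain ⟨a, _, ha⟩ := mem_map.1 (hy (Fin.last N) h)
        exact absurd ha (Fin.castSucc_ne_last a)
    calc (Fin.snoc (fun i => y (Fin.castSucc i)) false : Fin (N + 1) → Bool)
        = Fin.snoc (Fin.init y) (y (Fin.last N)) := by rw [hl]; rfl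
      _ = y := Fin.snoc_init_self y

/-! ### The tower on the hyperplane `{x_last = 0}` and the stub -/

/-- **The relative tower on the hyperplane `{x_last = 0}`.** Given Ax's parity theorem on coordinate cubes (`hAx`): if
`g` is cubic on `N + 1` bits and `W_g(x̄ ‖ 0) = 2^j u(x̄)` for all `x̄ ∈ 𝔽₂^N`, then `x̄ ↦ [u(x̄) odd]` has degree `≤ d`
whenever `j + 1 ≤ k + ⌈(N+1−k)/3⌉` for all `d < k ≤ N`. Proof: for `I ⊆ Fin N` with `|I| > d`, transport `E_I` to the
cube `E_{I'} ⊂ 𝔽₂^{N+1}` (`loh_sum_transport`), apply Poisson (`bb_poisson`) and Ax on `E_{I'ᶜ}` (`|I'ᶜ| = N + 1 − |I|`):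
`2^j Σ_{E_I} u = 2^{|I| + ⌈(N+1−|I|)/3⌉} z`, so `Σ_{E_I} u` is even (`tw_even_of_balance`), hence so is the number of
odd terms (`tw_even_sum_iff`); conclude by Möbius inversion on `N` variables (`bb_moebius_isDegLeFun`). -/
theorem loh_of_false
    (hAx : ∀ (n d : ℕ) (h : (Fin n → Bool) → Bool) (K : Finset (Fin n)), 1 ≤ d → IsDegLeFun d h →
      ∃ z : ℤ, ∑ x ∈ {u : Fin n → Bool | ∀ i, u i = true → i ∈ K}, signOf (h x) =
        (2 : ℝ) ^ ((K.card + d - 1) / d) * (z : ℝ))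
    (N j d : ℕ) (g : (Fin (N + 1) → Bool) → Bool) (u : (Fin N → Bool) → ℤ) (hg : IsDegLeFun 3 g)
    (hu : ∀ x : Fin N → Bool, W (fun y => signOf (g y)) (Fin.snoc x false) = (2 : ℝ) ^ j * (u x : ℝ))
    (hside : ∀ k, d < k → k ≤ N → j + 1 ≤ k + (N + 1 - k + 2) / 3) :
    IsDegLeFun d (fun x => decide (Odd (u x))) := by
  refine bb_moebius_isDegLeFun d (fun x => decide (Odd (u x))) fun I hI => ?_
  have hT := loh_sum_transport (fun y => W (fun y => signOf (g y)) y) I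
  have hP := bb_poisson (fun y => signOf (g y)) (I.map Fin.castSuccEmb)
  obtain ⟨z, hz⟩ := hAx (N + 1) 3 g (I.map Fin.castSuccEmb)ᶜ (by norm_num) hg
  generalize hc : ((I.map Fin.castSuccEmb)ᶜ.card + 3 - 1) / 3 = c at hz
  rw [← hT, sum_congr rfl fun x _ => hu x, ← mul_sum, hz, card_map] at hP
  have hk : #I ≤ N := (card_le_univ I).trans_eq (Fintype.card_fin N)
  have hj : #(I.map Fin.castSuccEmb)ᶜ = N + 1 - #I := by rw [card_compl, Fintype.card_fin, card_map]
  have hjc : j + 1 ≤ #I + c := by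
    have h := hside #I hI hk
    omega
  have hZ : (2 : ℤ) ^ j * ∑ x ∈ {x : Fin N → Bool | ∀ i, x i = true → i ∈ I}, u x = 2 ^ #I * (2 ^ c * z) := by
    have h' : (((2 : ℤ) ^ j * ∑ x ∈ {x : Fin N → Bool | ∀ i, x i = true → i ∈ I}, u x : ℤ) : ℝ) =
        (((2 : ℤ) ^ #I * (2 ^ c * z) : ℤ) : ℝ) := by
      push_cast
      exact hP
    exact_mod_cast h'
  have hE := (tw_even_sum_iff _ u).1 (tw_even_of_balance hjc hZ)
  rw [filter_filter] at hE
  simpa only [decide_eq_true_eq] using hE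

/-- **The 2-adic Walsh tower relative to a coordinate hyperplane.**  Given Ax's parity theorem on coordinate cubes
(first antecedent = the landed `stub_axParity`): if `g` is cubic on `N + 1` bits and `W_g(x̄ ‖ b) = 2^j u(x̄)` with
`u(x̄) ∈ ℤ` on the hyperplane `{x_last = b}`, then `x̄ ↦ [u(x̄) odd]` has degree `≤ d` whenever
`j + 1 ≤ k + ⌈(N+1−k)/3⌉` for all `d < k ≤ N`.  Reduce to `b = 0` by the Walsh shift `g ↦ g ⊕ (b ∧ y_last)`
(`loh_W_snoc`, `loh_isDegLeFun_shift`), then `loh_of_false`. [Ax 1964 / McEliece 1972 + Poisson + Möbius, as in the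
landed `stub_walshTower`] -/
theorem stub_levelOnHyperplane :
    (∀ (n d : ℕ) (h : (Fin n → Bool) → Bool) (K : Finset (Fin n)), 1 ≤ d → IsDegLeFun d h →
      ∃ z : ℤ, ∑ x ∈ {u : Fin n → Bool | ∀ i, u i = true → i ∈ K}, signOf (h x) =
        (2 : ℝ) ^ ((K.card + d - 1) / d) * (z : ℝ)) →
    ∀ (N j d : ℕ) (g : (Fin (N + 1) → Bool) → Bool) (b : Bool) (u : (Fin N → Bool) → ℤ), IsDegLeFun 3 g →
      (∀ x : Fin N → Bool, W (fun y => signOf (g y)) (Fin.snoc x b) = (2 : ℝ) ^ j * (u x : ℝ)) →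
      (∀ k, d < k → k ≤ N → j + 1 ≤ k + (N + 1 - k + 2) / 3) →
      IsDegLeFun d (fun x => decide (Odd (u x))) := by
  intro hAx N j d g b u hg hu hside
  refine loh_of_false hAx N j d (fun y => g y ^^ (y (Fin.last N) && b)) u (loh_isDegLeFun_shift hg b)
    (fun x => ?_) hside
  rw [← loh_W_snoc g x b]
  exact hu x

end Summit.QuantumAdvantage.QuantumAdvantage.Theorems.CubicForrelation.NearExactIsExact
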